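import Literature.NumberTheory.Automorphic.BrandtHeckeFamily
import Literature.NumberTheory.Automorphic.DefiniteOrderUnitsTorsion
import Literature.NumberTheory.Automorphic.BrandtIndexReducedNorm
import Literature.NumberTheory.Automorphic.RamifiedPrimeIdeal
import Summits.BirchSwinnertonDyer.BirchSwinnertonDyer.Theorems.RamifiedHeegnerPairLeafPartnerBrandtCornerLines
import Summits.BirchSwinnertonDyer.BirchSwinnertonDyer.Theorems.RamifiedHeegnerPairLeafPartnerBrandtWeightDvd
import Summits.BirchSwinnertonDyer.BirchSwinnertonDyer.Theorems.RamifiedHeegnerPairLeafPartnerBrandtExactEisenstein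
import HarnessLib

/-!
# Route `RamifiedHeegnerPair`, crux U₁ `LeafRankOneUpperAtThree` (stmt-BirchSwinnertonDyer-26022), line `partnerdescent` —
# input (C4) of the (G3♭ˢ) derivation: the FIXED-POINT EXCLUSION on Brandt sets, hence (DIV) `w_k ∣ T(ℓ)_{ik}` (`i ≠ k`)
# and the EXACT Eisenstein property of the Brandt component group, unconditionally

HONEST FRAMING. Theorems only; helper file (`--supports stmt-BirchSwinnertonDyer-26022 --as helper`); elementary algebra over
the tree's Brandt vocabulary (`Brandt.XiSetup`, `Brandt.matrix`, `Brandt.weight`, the residually-split dictionary `LatQuot` /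
`IsMatrixUnitAction` / `corner` of `BrandtModuleSplitLattices.lean`, `BrandtModuleMatrixUnits.lean`, reduced norms and traces of
`QuaternionInvolutionToolkit.lean` / `QuaternionOrderIntegral.lean`); no named fact, no `sorry`; nothing booked; BSD is proved for no
curve. Lead prover bsd-line-rhp-p2 g62, 2026-08-31 (memo `Cruxes/LeafRankOneUpperAtThree/LEAD-G61-G3-CORE.md` §7–§8: the one brick left
open there). Abstract bricks: ‹…LeafPartnerBrandtCornerLines›.

WHAT. Let `S` be a Brandt setup of type `(N⁺, N⁻)` (Eichler order `O`, class representatives `I_c`, `w_c = #O_L(I_c)^× / 2`), `ℓ`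
a prime with `ℓ ∤ N⁺N⁻`, and `i ≠ k` two classes. **Fixed-point exclusion** (`XiSetup.eq_one_or_eq_neg_one_of_smul_eq_of_ne`): if a
unit `u` with `uI_k = I_k` fixes a sub-ideal `J = αI_i ⊆ I_k` of index `ℓ²`, then `u = ±1`. Proof (memo §8): `u ≠ ±1` has `nrd u = 1`,
`trd u = t ∈ {0, ±1}` (tree: integrality of `trd`, `trd(u)² ≤ 4`, `t = ±2 ⟹ u = ±1`), so `u² = tu − 1`; `ℓI_k ⊆ J` (Kaplansky, tree
`IsInvertibleRightIdeal.natCast_smul_le_of_relIndex_eq_sq`); in the `M₂(𝔽_ℓ)`-module `V = I_k/ℓI_k` (matrix units of the residually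
split `O`, tree `XiSetup.isResiduallySplit`) the corner `T` of `J/ℓI_k` is a line of the plane `G = Ve` stable under left
multiplication by `u`, which acts on it by a scalar `λ` with `ℓ ∣ λ² − tλ + 1`; a norm-`ℓ` element `π = a + bu` with
`ℓ ∣ a + b(t − λ)` exists (‹…CornerLines› §3), and left multiplication by `π` maps `G` onto `T` (rank count with `π̄ = (a + tb) − bu`:
`π̄π = ℓ`, `π̄ = 0` on `T`, neither `π` nor `π̄` kills `G` since `[I_k : πI_k] = nrd(π)² = ℓ² ≠ r·ℓ⁴`), so `πI_k/ℓI_k` and `J/ℓI_k`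
have the same corner, hence coincide, hence `J = πI_k` and `[I_i] = [J] = [I_k]`, contradiction. CONSEQUENCES, all unconditional:
(DIV) `w_k ∣ T(ℓ)_{ik}` for `i ≠ k` (`XiSetup.weight_dvd_matrix_of_ne`, via ‹…BrandtWeightDvd›'s Burnside count); the exact Eisenstein
property `(T_ℓ − ℓ − 1)·B^∨ ⊆ B` of `Φ = B^∨/B`, `B = ℤ[Cls O]⁰` (`exact_eisenstein`, via ‹…BrandtExactEisenstein›); and the exact
Eisenstein divisibility `d ∣ λ(ℓ) − (ℓ + 1)` for a unimodular Hecke eigenvector (`dvd_sub_of_eigenvector`; for `g = g_r`, `d = i_r`: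
`i_r ∣ a_ℓ − ℓ − 1` with NO factor `12`, valid at `3`). [cite: Voight2021, (41.1.1), 41.1.3, Lemma 17.7.13] [cite: Eichler1973, Ch. II §6 Thm. 2]
[cite: Gross1987, §1] [cite: Ribet1990, §3 Thm. 3.12]
-/

set_option linter.dupNamespace false
set_option autoImplicit false

noncomputable section

open scoped Pointwise

namespace Summit.BirchSwinnertonDyer.BirchSwinnertonDyer.Theorems.LeafPartnerBrandt

open Literature.NumberTheory.Automorphic Literature.NumberTheory.Automorphic.Brandt
open Literature.NumberTheory.Automorphic.IsMatrixUnitAction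

/-! ## 5. The fixed-point exclusion for a Brandt setup, (DIV), and the exact Eisenstein property -/

section FPE

variable {Nplus Nminus : ℕ} (S : XiSetup Nplus Nminus)

/-- An index bookkeeping triviality: `r · ℓ⁴ ≠ ℓ²` for a prime `ℓ`. [folklore] -/
theorem mul_pow_four_ne_sq {ℓ : ℕ} (hℓ : ℓ.Prime) (r : ℕ) : r * ℓ ^ 4 ≠ ℓ ^ 2 := by
  intro h
  have hlt : ℓ ^ 2 < ℓ ^ 4 := Nat.pow_lt_pow_right hℓ.one_lt (by norm_num)
  rcases Nat.eq_zero_or_pos r with rfl | hr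
  · rw [zero_mul] at h
    exact pow_ne_zero 2 hℓ.ne_zero h.symm
  · have : ℓ ^ 4 ≤ r * ℓ ^ 4 := Nat.le_mul_of_pos_left _ hr
    omega

/-- **Fixed-point exclusion (FPE).** For a Brandt setup `S` of type `(N⁺, N⁻)`, a prime `ℓ ∤ N⁺N⁻`, classes `i ≠ k`, a unit `u`
with `u I_k = I_k` and a sub-ideal `J = αI_i ⊆ I_k` of index `ℓ²` with `uJ = J`: `u = ±1`. (Otherwise `u² = tu − 1` with
`t ∈ {0, ±1}`; `ℓI_k ⊆ J`; in `I_k/ℓI_k` the corner line of `J` is `u`-stable with eigenvalue `λ`, `ℓ ∣ λ² − tλ + 1`; a norm-`ℓ`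
element `π = a + bu` with `ℓ ∣ a + b(t − λ)` has `πI_k/ℓI_k` with the same corner, so `J = πI_k ∈ [I_k]`.) This is the hypothesis
`hfree` of ‹…BrandtWeightDvd›'s `XiSetup.weight_dvd_matrix_of_forall_smul_ne` for `i ≠ k`, `n = ℓ`.
[cite: Voight2021, (41.1.1), 41.1.3, Lemma 17.7.13] [cite: Eichler1973, Ch. II §6 Thm. 2] -/
theorem XiSetup.eq_one_or_eq_neg_one_of_smul_eq_of_ne {ℓ : ℕ} (hℓ : ℓ.Prime) (hℓN : ¬ ℓ ∣ Nplus * Nminus)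
    {i k : ClassSet S.O} (hik : i ≠ k) {u : S.Dˣ} (hu : u • k.rep = k.rep) {J : Submodule ℤ S.D}
    (hJ : J ∈ {J : Submodule ℤ S.D | J ≤ k.rep ∧ J.toAddSubgroup.relIndex k.rep.toAddSubgroup = ℓ ^ 2 ∧
      ∃ α : S.Dˣ, J = α • i.rep})
    (huJ : u • J = J) : u = 1 ∨ u = -1 := by
  classical
  haveI : Fact ℓ.Prime := ⟨hℓ⟩
  haveI : IsAddTorsionFree S.D := isAddTorsionFree_of_charZero_module ℚ S.D
  obtain ⟨hJle, hJidx, α, hJα⟩ := hJ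
  by_contra hne
  push Not at hne
  obtain ⟨hu1, hu2⟩ := hne
  apply hik
  -- it suffices to exhibit a unit `π` with `J = π I_k`
  suffices h : ∃ π : S.Dˣ, J = π • k.rep by
    obtain ⟨π, hπ⟩ := h
    refine i.mk_rep.symm.trans ((Quotient.sound ?_).trans k.mk_rep)
    exact ⟨π⁻¹ * α, by rw [mul_smul, ← hJα, hπ, inv_smul_smul]⟩
  -- ambient facts
  have hdiv : ∀ x : S.D, x ≠ 0 → IsUnit x := fun x hx => isUnit_of_isTotallyDefinite S.D S.isTotallyDefinite hx
  have hO : IsZOrder S.O := (isEichlerOrder_iff_brandt.mpr S.isEichlerOrder).isZOrder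
  set I : Submodule ℤ S.D := k.rep with hIdef
  have hIinv : IsInvertibleRightIdeal S.O I := isInvertibleRightIdeal_of_mem_rightIdeals k.rep_mem
  have hIfull : IsFullLattice S.D I := k.rep_mem.1
  have hJinv : IsInvertibleRightIdeal S.O J := by
    rw [hJα]; exact (isInvertibleRightIdeal_of_mem_rightIdeals i.rep_mem).units_smul α
  have hIO : ∀ x ∈ I, ∀ o ∈ S.O, x * o ∈ I := fun x hx o ho => by
    have ho' : o ∈ rightOrder I := by rw [hIdef, k.rep_mem.2.1]; exact ho
    exact ho' x hx
  have hJO : ∀ x ∈ J, ∀ o ∈ S.O, x * o ∈ J := by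
    intro x hx o ho
    rw [hJα] at hx ⊢
    obtain ⟨m, hm, rfl⟩ := (Submodule.mem_smul_pointwise_iff_exists x α i.rep).mp hx
    have hmo : (α • m : S.D) * o = α • (m * o) := by
      rw [Units.smul_def, Units.smul_def, smul_eq_mul, smul_eq_mul, mul_assoc]
    rw [hmo]
    have ho' : o ∈ rightOrder i.rep := by rw [i.rep_mem.2.1]; exact ho
    exact Submodule.smul_mem_pointwise_smul _ α i.rep (ho' m hm)
  -- Kaplansky: `ℓ I ⊆ J`; the pair `K = ℓ I ≤ I`
  have hKJ : ((ℓ : ℤ) • I : Submodule ℤ S.D) ≤ J := hJinv.natCast_smul_le_of_relIndex_eq_sq hdiv hO hIinv hJle hJidx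
  set K : Submodule ℤ S.D := (ℓ : ℤ) • I with hKdef
  have hKI : K ≤ I := fun x hx => by
    obtain ⟨m, hm, rfl⟩ := (Submodule.mem_smul_pointwise_iff_exists x (ℓ : ℤ) I).mp hx
    exact I.smul_mem _ hm
  have hKleft : ∀ z ∈ leftOrder I, ∀ x ∈ K, z * x ∈ K := fun z hz x hx => by
    obtain ⟨m, hm, rfl⟩ := (Submodule.mem_smul_pointwise_iff_exists x (ℓ : ℤ) I).mp hx
    rw [mul_smul_comm]
    exact Submodule.smul_mem_pointwise_smul _ (ℓ : ℤ) I (hz m hm)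
  have hIK : IsLatticePair S.O ℓ I K :=
    ⟨hKI, hIO, fun x hx o ho => by
      obtain ⟨m, hm, rfl⟩ := (Submodule.mem_smul_pointwise_iff_exists x (ℓ : ℤ) I).mp hx
      rw [smul_mul_assoc]
      exact Submodule.smul_mem_pointwise_smul _ (ℓ : ℤ) I (hIO m hm o ho),
    fun x hx => Submodule.smul_mem_pointwise_smul x (ℓ : ℤ) I hx⟩
  -- matrix units modulo `ℓ` and the `M₂(𝔽_ℓ)`-module `V = I / ℓ I`
  obtain ⟨e, eu, ev, hmu⟩ := (S.isResiduallySplit hℓ hℓN).exists_isMatrixUnitsMod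
  have hact := isMatrixUnitAction_actQ hmu hIK
  -- indices
  have hKidx : K.toAddSubgroup.relIndex I.toAddSubgroup = ℓ ^ 4 := relIndex_natCast_smul_eq_pow_four hIfull hℓ.ne_zero
  have hJK : K.toAddSubgroup.relIndex J.toAddSubgroup = ℓ ^ 2 := by
    have h := AddSubgroup.relIndex_mul_relIndex K.toAddSubgroup J.toAddSubgroup I.toAddSubgroup
      (Submodule.toAddSubgroup_mono hKJ) (Submodule.toAddSubgroup_mono hJle)
    rw [hJidx, hKidx, show ℓ ^ 4 = ℓ ^ 2 * ℓ ^ 2 by ring] at h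
    exact mul_right_cancel₀ (pow_ne_zero 2 hℓ.ne_zero) h
  -- the plane `G` (corner of `V`) and the line `T` (corner of `J / ℓ I`)
  have hG : Nat.card (corner (actE hmu hIK) (⊤ : AddSubgroup (LatQuot I K))) = ℓ ^ 2 := by
    have h := relIndex_eq_corner_sq hmu hIK
    rw [hKidx, show ℓ ^ 4 = (ℓ ^ 2) ^ 2 by ring] at h
    exact (Nat.pow_left_injective two_ne_zero h).symm
  have hSJ : IsStable (actE hmu hIK) (actU hmu hIK) (actV hmu hIK) (subOf I K J) := isStable_subOf hmu hIK hJO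
  have hT : Nat.card (corner (actE hmu hIK) (subOf I K J)) = ℓ := by
    have h := hact.card_eq_corner_sq hSJ
    rw [card_subOf hJle, hJK] at h
    exact (Nat.pow_left_injective two_ne_zero h).symm
  have hTG : corner (actE hmu hIK) (subOf I K J) ≤ corner (actE hmu hIK) ⊤ := corner_mono le_top
  -- the unit `u`: `u ∈ O_L(I)`, `nrd u = 1`, `trd u = t ∈ {0, ±1}`, `u² = t u − 1`
  obtain ⟨huL, huL'⟩ := (mem_stabilizer_iff_mem_leftOrder I u).mp (MulAction.mem_stabilizer_iff.mpr hu)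
  have hOL : IsOrder S.D (leftOrder I) := isOrder_leftOrder hIfull
  have hnu : reducedNorm ℚ S.D u = 1 :=
    (hOL.exists_inv_mem_iff_of_isTotallyDefinite S.isTotallyDefinite huL).mp ⟨_, huL', u.mul_inv, u.inv_mul⟩
  obtain ⟨t, -, ht, -⟩ := hOL.exists_int_reducedTrace_reducedNorm huL
  have htsq : t ^ 2 ≤ 4 := by
    have h := reducedTrace_sq_le_four S.isTotallyDefinite hnu
    rw [ht] at h
    exact_mod_cast h
  have huu : (u : S.D) * u = (t : ℤ) • (u : S.D) - 1 := by
    rw [mul_self_eq_smul_sub ℚ (u : S.D), ht, hnu, map_one, Int.cast_smul_eq_zsmul]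
  have sq_zero : ∀ a : S.D, a * a = 0 → a = 0 := fun a ha => by
    by_contra h
    obtain ⟨w, hw⟩ := hdiv a h
    have : (w : S.D) = 0 := by
      have := congrArg (fun y => (↑w⁻¹ : S.D) * y) ha
      simpa [← hw, ← mul_assoc] using this
    exact h (hw ▸ this)
  have ht3 : t = -1 ∨ t = 0 ∨ t = 1 := by
    have hlo : -2 ≤ t := by nlinarith [htsq, sq_nonneg (t + 2), sq_nonneg (t - 2)]
    have hhi : t ≤ 2 := by nlinarith [htsq, sq_nonneg (t + 2), sq_nonneg (t - 2)]
    have hm2 : t ≠ -2 := by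
      rintro rfl
      apply hu2
      have h : ((u : S.D) + 1) * ((u : S.D) + 1) = 0 := by
        rw [add_mul, mul_add, mul_one, one_mul, huu, neg_smul, two_smul]; abel
      exact Units.ext (eq_neg_of_add_eq_zero_left (sq_zero _ h))
    have hp2 : t ≠ 2 := by
      rintro rfl
      apply hu1
      have h : ((u : S.D) - 1) * ((u : S.D) - 1) = 0 := by
        rw [sub_mul, mul_sub, mul_one, one_mul, huu, two_smul]; abel
      exact Units.ext (sub_eq_zero.mp (sq_zero _ h))
    omega
  -- left multiplication by `u` on `V`; it preserves `J / ℓ I` and its corner `T`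
  have huJ' : ∀ m ∈ J, (u : S.D) * m ∈ J := (units_smul_le_iff_mem_leftOrder J u).mp huJ.le
  obtain ⟨φ, hφ⟩ := exists_latQuot_mulLeft (M := I) (K := K) (u : S.D) huL (hKleft _ huL)
  have hφE : ∀ y, actE hmu hIK (φ y) = φ (actE hmu hIK y) := actQ_mulLeft_comm _ _ huL hφ
  have hφS : ∀ y ∈ subOf I K J, φ y ∈ subOf I K J := by
    intro y hy
    obtain ⟨x, hxJ, rfl⟩ := mem_subOf.mp hy
    rw [hφ]
    exact mem_subOf.mpr ⟨⟨u * x, huL _ x.2⟩, huJ' _ hxJ, rfl⟩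
  have hφT : ∀ y ∈ corner (actE hmu hIK) (subOf I K J), φ y ∈ corner (actE hmu hIK) (subOf I K J) :=
    fun y hy => apply_mem_corner_of_comm φ hφE hφS hy
  have hφφ : ∀ y, φ (φ y) = t • φ y - y := by
    intro y
    obtain ⟨x, rfl⟩ := QuotientAddGroup.mk'_surjective (latRes I K) y
    rw [hφ, hφ, ← map_zsmul, ← map_sub]
    congr 1
    apply Subtype.ext
    simp only [Submodule.coe_sub, Submodule.coe_smul_of_tower]
    rw [← mul_assoc, huu, sub_mul, one_mul, smul_mul_assoc]
  obtain ⟨lam, hlam⟩ := exists_eq_smul_of_card_eq_prime hℓ hT hφT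
  have hroot : (ℓ : ℤ) ∣ lam ^ 2 - t * lam + 1 :=
    dvd_of_eigenvalue hℓ hT (fun y _ => hφφ y) hlam
  -- the norm-`ℓ` element `π = a + b u` and its conjugate `π' = (a + t b) − b u`
  obtain ⟨a, b, hab, habdvd⟩ := exists_norm_eq_prime_and_dvd ht3 hℓ hroot
  set π : S.D := (a : ℚ) • (1 : S.D) + (b : ℚ) • (u : S.D) with hπdef
  set π' : S.D := ((a + t * b : ℤ) : ℚ) • (1 : S.D) - (b : ℚ) • (u : S.D) with hπ'def
  have hπL : π ∈ leftOrder I := by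
    rw [hπdef, Int.cast_smul_eq_zsmul, Int.cast_smul_eq_zsmul]
    exact (leftOrder I).add_mem ((leftOrder I).smul_mem _ (one_mem_leftOrder I)) ((leftOrder I).smul_mem _ huL)
  have hπ'L : π' ∈ leftOrder I := by
    rw [hπ'def, Int.cast_smul_eq_zsmul, Int.cast_smul_eq_zsmul]
    exact (leftOrder I).sub_mem ((leftOrder I).smul_mem _ (one_mem_leftOrder I)) ((leftOrder I).smul_mem _ huL)
  have hubar : standardInvolution ℚ S.D u = (t : ℚ) • (1 : S.D) - u := by
    rw [standardInvolution, ht, Algebra.algebraMap_eq_smul_one]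
  have hπbar : standardInvolution ℚ S.D π = π' := by
    rw [hπdef, hπ'def, standardInvolution_add, standardInvolution_smul, standardInvolution_smul, standardInvolution_one,
      hubar, smul_sub, smul_smul]
    push_cast
    rw [add_smul, mul_comm (t : ℚ) (b : ℚ)]
    abel
  have hnrd : reducedNorm ℚ S.D π = ℓ := by
    have h1 : reducedNorm ℚ S.D π = (a : ℚ) ^ 2 + (b : ℚ) ^ 2 + (a * b : ℚ) * t := by
      rw [hπdef, reducedNorm_add, reducedNorm_smul, reducedNorm_smul, reducedNorm_one, hnu, standardInvolution_smul,
        smul_mul_assoc, one_mul, smul_smul, map_smul, reducedTrace_standardInvolution, ht, smul_eq_mul]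
      ring
    rw [h1]
    have h2 : ((a ^ 2 + t * a * b + b ^ 2 : ℤ) : ℚ) = (ℓ : ℚ) := by exact_mod_cast hab
    push_cast at h2
    linear_combination h2
  have hnrd' : reducedNorm ℚ S.D π' = ℓ := by rw [← hπbar, reducedNorm_standardInvolution, hnrd]
  have hππ' : π * π' = algebraMap ℚ S.D ℓ := by rw [← hπbar, mul_standardInvolution_holds ℚ S.D π, hnrd]
  have hπ'π : π' * π = algebraMap ℚ S.D ℓ := by rw [← hπbar, IsQuaternionAlgebra.standardInvolution_mul, hnrd]
  have hℓ0 : (ℓ : ℚ) ≠ 0 := by exact_mod_cast hℓ.ne_zero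
  have hπ0 : π ≠ 0 := fun h => hℓ0 (by rw [← hnrd, h, reducedNorm_apply_zero])
  have hπ'0 : π' ≠ 0 := fun h => hℓ0 (by rw [← hnrd', h, reducedNorm_apply_zero])
  -- scalar action of `ℓ` on `I` lands in `K`
  have hℓI : ∀ x ∈ I, algebraMap ℚ S.D ℓ * x ∈ K := fun x hx => by
    rw [← Algebra.smul_def, Nat.cast_smul_eq_nsmul, ← natCast_zsmul]
    exact Submodule.smul_mem_pointwise_smul x (ℓ : ℤ) I hx
  -- left multiplications by `π`, `π'` on `V`
  obtain ⟨ψ, hψ⟩ := exists_latQuot_mulLeft (M := I) (K := K) π hπL (hKleft _ hπL)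
  obtain ⟨ψ', hψ'⟩ := exists_latQuot_mulLeft (M := I) (K := K) π' hπ'L (hKleft _ hπ'L)
  have hψE : ∀ y, actE hmu hIK (ψ y) = ψ (actE hmu hIK y) := actQ_mulLeft_comm _ _ hπL hψ
  have hψU : ∀ y, actU hmu hIK (ψ y) = ψ (actU hmu hIK y) := actQ_mulLeft_comm _ _ hπL hψ
  have hψW : ∀ y, actV hmu hIK (ψ y) = ψ (actV hmu hIK y) := actQ_mulLeft_comm _ _ hπL hψ
  have hψ'E : ∀ y, actE hmu hIK (ψ' y) = ψ' (actE hmu hIK y) := actQ_mulLeft_comm _ _ hπ'L hψ'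
  have hψ'U : ∀ y, actU hmu hIK (ψ' y) = ψ' (actU hmu hIK y) := actQ_mulLeft_comm _ _ hπ'L hψ'
  -- `ψ' ψ = 0`
  have hcomp : ∀ y, ψ' (ψ y) = 0 := by
    intro y
    obtain ⟨x, rfl⟩ := QuotientAddGroup.mk'_surjective (latRes I K) y
    rw [hψ, hψ', latMk_eq_zero_iff]
    change π' * (π * (x : S.D)) ∈ K
    rw [← mul_assoc, hπ'π]
    exact hℓI _ x.2
  -- `ψ = a + b φ`, `ψ' = (a + t b) − b φ`
  have hψφ : ∀ y, ψ y = a • y + b • φ y := by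
    intro y
    obtain ⟨x, rfl⟩ := QuotientAddGroup.mk'_surjective (latRes I K) y
    rw [hψ, hφ, ← map_zsmul, ← map_zsmul, ← map_add]
    congr 1
    apply Subtype.ext
    simp only [Submodule.coe_add, Submodule.coe_smul_of_tower]
    rw [hπdef, add_mul, smul_mul_assoc, one_mul, smul_mul_assoc, Int.cast_smul_eq_zsmul, Int.cast_smul_eq_zsmul]
  have hψ'φ : ∀ y, ψ' y = (a + t * b) • y - b • φ y := by
    intro y
    obtain ⟨x, rfl⟩ := QuotientAddGroup.mk'_surjective (latRes I K) y
    rw [hψ', hφ, ← map_zsmul, ← map_zsmul, ← map_sub]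
    congr 1
    apply Subtype.ext
    simp only [Submodule.coe_sub, Submodule.coe_smul_of_tower]
    rw [hπ'def, sub_mul, smul_mul_assoc, one_mul, smul_mul_assoc, Int.cast_smul_eq_zsmul, Int.cast_smul_eq_zsmul]
  -- `ψ'` kills the line `T`
  have hT0 : ∀ y ∈ corner (actE hmu hIK) (subOf I K J), ψ' y = 0 := by
    intro y hy
    obtain ⟨m, hm⟩ := habdvd
    rw [hψ'φ, hlam y hy, smul_smul, ← sub_smul, show a + t * b - b * lam = a + b * (t - lam) by ring, hm, mul_comm,
      mul_smul, natCast_zsmul]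
    rw [smul_latQuot_eq_zero hIK, smul_zero]
  -- `ψ`, `ψ'` preserve `G`; neither vanishes on `G` (index count `[I : πI] = ℓ² ≠ r ℓ⁴`)
  have hψG : ∀ y ∈ corner (actE hmu hIK) (⊤ : AddSubgroup (LatQuot I K)), ψ y ∈ corner (actE hmu hIK) ⊤ :=
    fun y hy => apply_mem_corner_of_comm ψ hψE (fun _ _ => AddSubgroup.mem_top _) hy
  have hψ'G : ∀ y ∈ corner (actE hmu hIK) (⊤ : AddSubgroup (LatQuot I K)), ψ' y ∈ corner (actE hmu hIK) ⊤ :=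
    fun y hy => apply_mem_corner_of_comm ψ' hψ'E (fun _ _ => AddSubgroup.mem_top _) hy
  have key : ∀ (ρ : S.D) (hρL : ρ ∈ leftOrder I) (hρ0 : ρ ≠ 0) (hρn : reducedNorm ℚ S.D ρ = ℓ)
      (χ : LatQuot I K →+ LatQuot I K) (hχ : ∀ x : I, χ (latMk I K x) = latMk I K ⟨ρ * x, hρL _ x.2⟩)
      (hχU : ∀ y, actU hmu hIK (χ y) = χ (actU hmu hIK y)),
      ∃ y ∈ corner (actE hmu hIK) (⊤ : AddSubgroup (LatQuot I K)), χ y ≠ 0 := by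
    intro ρ hρL hρ0 hρn χ hχ hχU
    by_contra h0
    push Not at h0
    have hall : ∀ y, χ y = 0 := eq_zero_of_forall_corner_eq_zero hact χ hχU h0
    set ρu : S.Dˣ := (hdiv ρ hρ0).unit with hρu
    have hρuval : (ρu : S.D) = ρ := (hdiv ρ hρ0).unit_spec
    have hρuL : (ρu : S.D) ∈ leftOrder I := by rw [hρuval]; exact hρL
    have hle : ρu • I ≤ K := by
      intro z hz
      obtain ⟨x, hx, rfl⟩ := (Submodule.mem_smul_pointwise_iff_exists z ρu I).mp hz
      have h := hall (latMk I K ⟨x, hx⟩)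
      rw [hχ, latMk_eq_zero_iff] at h
      rw [Units.smul_def, hρuval, smul_eq_mul]
      exact h
    have hidx : (ρu • I).toAddSubgroup.relIndex I.toAddSubgroup = ℓ ^ 2 :=
      (relIndex_units_smul_eq_sq_iff S.isTotallyDefinite hIfull hρuL ℓ).mpr (by rw [hρuval, hρn])
    have h := AddSubgroup.relIndex_mul_relIndex (ρu • I).toAddSubgroup K.toAddSubgroup I.toAddSubgroup
      (Submodule.toAddSubgroup_mono hle) (Submodule.toAddSubgroup_mono hKI)
    rw [hidx, hKidx] at h
    exact mul_pow_four_ne_sq hℓ _ h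
  have hψne := key π hπL hπ0 hnrd ψ hψ hψU
  have hψ'ne := key π' hπ'L hπ'0 hnrd' ψ' hψ' hψ'U
  -- rank count: `ψ(G) = T`
  have hGT : (corner (actE hmu hIK) ⊤).map ψ = corner (actE hmu hIK) (subOf I K J) :=
    map_eq_of_comp_eq_zero hℓ hG hT hTG hψG (fun y _ => hcomp y) hT0 hψne hψ'ne
  -- hence `π I / ℓ I` and `J / ℓ I` have the same corner, so they coincide, so `π I = J`
  set πu : S.Dˣ := (hdiv π hπ0).unit with hπu
  have hπuval : (πu : S.D) = π := (hdiv π hπ0).unit_spec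
  have hπuI : ∀ x ∈ I, (πu : S.D) * x ∈ I := fun x hx => by rw [hπuval]; exact hπL x hx
  have hψu : ∀ x : I, ψ (latMk I K x) = latMk I K ⟨πu * x, hπuI _ x.2⟩ := fun x =>
    (hψ x).trans (congrArg _ (Subtype.ext (show π * (x : S.D) = (πu : S.D) * x by rw [hπuval])))
  have hSπ : subOf I K (πu • I) = (⊤ : AddSubgroup (LatQuot I K)).map ψ := subOf_units_smul_eq_map_top hπuI hψu
  have hSπst : IsStable (actE hmu hIK) (actU hmu hIK) (actV hmu hIK) (subOf I K (πu • I)) := by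
    rw [hSπ]; exact isStable_map_top ψ hψE hψU hψW
  have hcorner : corner (actE hmu hIK) (subOf I K (πu • I)) = corner (actE hmu hIK) (subOf I K J) := by
    rw [hSπ, corner_map_top_eq_map_corner hact ψ hψE, hGT]
  have hsub : subOf I K (πu • I) = subOf I K J := by
    rw [← hact.ofCorner_corner hSπst, hcorner, hact.ofCorner_corner hSJ]
  have hπI : πu • I ≤ I := (units_smul_le_iff_mem_leftOrder I πu).mpr (by rw [hπuval]; exact hπL)
  have hKπ : K ≤ πu • I := by
    intro z hz
    obtain ⟨x, hx, rfl⟩ := (Submodule.mem_smul_pointwise_iff_exists z (ℓ : ℤ) I).mp hz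
    have h : ((ℓ : ℤ) • x : S.D) = (πu : S.D) * (π' * x) := by
      rw [hπuval, ← mul_assoc, hππ', ← Algebra.smul_def, Nat.cast_smul_eq_nsmul ℚ, natCast_zsmul]
    rw [h, ← smul_eq_mul, ← Units.smul_def]
    exact Submodule.smul_mem_pointwise_smul _ πu I (hπ'L x hx)
  refine ⟨πu, ?_⟩
  rw [← latOf_subOf hKJ hJle, ← hsub, latOf_subOf hKπ hπI]

end FPE

/-! ## 6. Consequences: (DIV) and the exact Eisenstein property, unconditionally -/

section Consequences

open ArithmeticFunction

variable {Nplus Nminus : ℕ} (S : XiSetup Nplus Nminus)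

/-- **(DIV) `w_k ∣ T(ℓ)_{ik}` for `i ≠ k` and every prime `ℓ ∤ N⁺N⁻`, unconditionally**: the stabiliser `O_L(I_k)^×` (order `2w_k`)
acts on the set counted by `T(ℓ)_{ik}` with all orbits of size `w_k` (Burnside, ‹…BrandtWeightDvd›), because by the fixed-point
exclusion only `±1` have fixed points. [cite: Voight2021, (41.1.1), 41.1.3, Lemma 17.7.13] [cite: Eichler1973, Ch. II §6 Thm. 2] -/
theorem XiSetup.weight_dvd_matrix_of_ne {ℓ : ℕ} (hℓ : ℓ.Prime) (hℓN : ¬ ℓ ∣ Nplus * Nminus) {i k : ClassSet S.O}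
    (hik : i ≠ k) : (weight S.O k : ℤ) ∣ matrix S.O ℓ i k :=
  XiSetup.weight_dvd_matrix_of_forall_smul_ne S hℓ.ne_zero i k
    (fun _ hu _ hJ huJ => XiSetup.eq_one_or_eq_neg_one_of_smul_eq_of_ne S hℓ hℓN hik hu hJ huJ)

variable [Fintype (ClassSet S.O)] [DecidableEq (ClassSet S.O)]

/-- **The component group `Φ = B^∨/B` of the degree-zero Brandt lattice is EXACTLY Eisenstein at every prime `ℓ ∤ N⁺N⁻`**,
unconditionally: for `x ∈ B^∨` (`deg x = 0`, `Σ_c w_c x_c b_c ∈ ℤ` for all `b` of degree `0`), `T(ℓ)x − (ℓ + 1)x` is integral of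
degree `0`, i.e. `(T_ℓ − ℓ − 1)·B^∨ ⊆ B`. ‹…BrandtExactEisenstein›'s `exact_eisenstein_of_weight_dvd` with (DIV) discharged by
`XiSetup.weight_dvd_matrix_of_ne`. In the (G3♭ˢ) derivation: Gross's pairing is perfect on `B_𝔪` at every non-Eisenstein `𝔪`,
residue characteristic `3` included (input (C4)). [cite: Ribet1990, Prop. 3.1–3.2, Thm. 3.12] [cite: Gross1987, §1–§2] -/
theorem exact_eisenstein {ℓ : ℕ} (hℓ : ℓ.Prime) (hℓN : ¬ ℓ ∣ Nplus * Nminus) (x : ClassSet S.O → ℚ)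
    (hdeg : S.degree x = 0)
    (hdual : ∀ b : ClassSet S.O → ℤ, ∑ c, b c = 0 → ∃ m : ℤ, ∑ c, (weight S.O c : ℚ) * x c * (b c : ℚ) = m) :
    (∀ i, ∃ m : ℤ, (Matrix.toLin' ((matrix S.O ℓ).map (Int.cast : ℤ → ℚ)) x - ((sigma 1 ℓ : ℕ) : ℚ) • x) i = m) ∧
      S.degree (Matrix.toLin' ((matrix S.O ℓ).map (Int.cast : ℤ → ℚ)) x - ((sigma 1 ℓ : ℕ) : ℚ) • x) = 0 :=
  exact_eisenstein_of_weight_dvd S hℓ.ne_zero ((Nat.Prime.coprime_iff_not_dvd hℓ).mpr hℓN)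
    (fun _ _ hik => XiSetup.weight_dvd_matrix_of_ne S hℓ hℓN hik) x hdeg hdual

/-- **`d ∣ λ(ℓ) − (ℓ + 1)`, exactly and unconditionally** (the tree's `Brandt.XiSetup.dvd_twelve_mul_sub_of_forall_dvd` WITHOUT the
factor `12`): `g` a common eigenvector of the `T(ℓ)` (`ℓ ∤ N⁺N⁻`) with eigenvalues `λ(ℓ)`, unimodular in `ℤ^{Cls O}`, `d` dividing every
`w_c g_c − w_{c'} g_{c'}`; then `d ∣ λ(ℓ) − (ℓ + 1)` at every prime `ℓ ∤ N⁺N⁻`. For `g = g_r`, `d = i_r` (the dictionary `hDict`): the EXACT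
Eisenstein divisibility `i_r ∣ a_ℓ − ℓ − 1`, valid at `3` (Pasten Lemma 6.14's input, Ribet 1990 Thm. 3.12).
[cite: Ribet1990, §3 Thm. 3.12] [cite: PastenShimura2024, Lemma 6.14 p. 23 (proof)] [cite: Eichler1973, Ch. II §6 Thm. 2 (17)] -/
theorem dvd_sub_of_eigenvector {lam : ℕ → ℤ} {g : ClassSet S.O → ℤ}
    (hg : g ∈ eigenLattice (Nplus * Nminus) (matrix S.O) lam)
    (hunimod : ∃ φ : Module.Dual ℤ (ClassSet S.O → ℤ), φ g = 1)
    {d : ℤ} (hcong : ∀ c c', d ∣ (weight S.O c : ℤ) * g c - (weight S.O c' : ℤ) * g c')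
    {ℓ : ℕ} (hℓ : ℓ.Prime) (hℓN : ¬ ℓ ∣ Nplus * Nminus) : d ∣ lam ℓ - (ℓ + 1) :=
  dvd_sub_of_eigenvector_of_weight_dvd S hg hunimod hcong hℓ hℓN
    (fun _ _ hik => XiSetup.weight_dvd_matrix_of_ne S hℓ hℓN hik)

end Consequences

end Summit.BirchSwinnertonDyer.BirchSwinnertonDyer.Theorems.LeafPartnerBrandt

end
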